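import Summits.Parity.GeneralizedHardyLittlewood.Theorems.PrimeLevelFamEdgeMomentsBeyondDiagonalFirstOrderUnbalanced
import HarnessLib

/-!
# Bettin's off-diagonal at ALL heights `t ≥ 1/(mN²)` and elementary size lemmas (helper for crux K_A
# `PrimeLevelFamEdge.MomentsBeyondDiagonal`, stmt-Parity-20007, stub `stub_first : SubFirst` ∀`Q`)

The order-`k` twisted first moment (unbalanced split + integration by parts, `…FirstOrderUnbalanced`) needs Bettin's
off-diagonal `OD_t(m) = Σ_n n^{−1/2}e^{−2πnt} J_N(m,n)` (Bettin 2017, §2 (2.4)–(2.5)) at EVERY height `t ≥ y_m = 1/(mN²)`.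
For `N` prime, `1 ≤ m ≤ N`: §1 elementary sizes (`t^j e^{−πt} ≤ j!/π^j`, the tail
`∫_a^∞ e^{−2πt}(log √N t)^j dt ≤ 2^j((log √N)^j + j!/π^j) e^{−πa}/π`); §2 the tree's split bound
`Bettin2017.norm_tsum_weight_mul_petJ_le` is monotone in the height (`‖OD_t(m)‖ ≤ B(y)` for `t ≥ y`); §3 at `y = 1/(mN²)`,
`R + 1 = m^{16}N^{28}`: `B(y) ≤ C₀ (1 + log N)³ √m / N`; §4 Weil termwise for `t ≥ 1`: `‖OD_t(m)‖ ≤ 4K m N^{−3/2} e^{−2πt}`.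
Proof only; no definition; nothing about Landau–Siegel zeros; K_A NOT proved.
-/

noncomputable section

open scoped Real
open Complex Set MeasureTheory Filter Topology Finset CongruenceSubgroup
open Literature.NumberTheory.EllipticCurves.ModularForms
open Literature.NumberTheory.LFunctions Literature.NumberTheory.LFunctions.KMV2000
open Literature.NumberTheory.LFunctions.KowalskiMichel2000

namespace Summit.Parity.GeneralizedHardyLittlewood.Theorems.MomentsBeyondDiagonal.FirstOrderAFE

/-! ## §1. Elementary sizes -/

/-- `t^j e^{−πt} ≤ j!/π^j` for `t ≥ 0` (`x^j/j! ≤ e^x` at `x = πt`). -/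
theorem pow_mul_exp_neg_pi_le (j : ℕ) {t : ℝ} (ht : 0 ≤ t) :
    t ^ j * Real.exp (-(π * t)) ≤ (j.factorial : ℝ) / π ^ j := by
  have h := Real.pow_div_factorial_le_exp (x := π * t) (by positivity) j
  rw [div_le_iff₀ (by positivity : (0 : ℝ) < j.factorial), mul_pow] at h
  rw [le_div_iff₀ (by positivity : 0 < π ^ j)]
  calc t ^ j * Real.exp (-(π * t)) * π ^ j = (π ^ j * t ^ j) * Real.exp (-(π * t)) := by ring
    _ ≤ (Real.exp (π * t) * j.factorial) * Real.exp (-(π * t)) :=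
        mul_le_mul_of_nonneg_right h (Real.exp_pos _).le
    _ = j.factorial := by
        rw [mul_assoc, mul_comm (j.factorial : ℝ), ← mul_assoc, ← Real.exp_add, add_neg_cancel,
          Real.exp_zero, one_mul]

variable {N : ℕ} [NeZero N]

/-- For `t ≥ 1` (`N ≥ 1`): `0 ≤ log(√N t) ≤ log √N + t`. -/
theorem log_sqrt_mul_bounds {t : ℝ} (ht : 1 ≤ t) :
    0 ≤ Real.log (Real.sqrt N * t) ∧ Real.log (Real.sqrt N * t) ≤ Real.log (Real.sqrt N) + t := by
  have hN1 : (1 : ℝ) ≤ N := by exact_mod_cast NeZero.one_le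
  have hs1 : 1 ≤ Real.sqrt N := by rw [← Real.sqrt_one]; exact Real.sqrt_le_sqrt hN1
  refine ⟨Real.log_nonneg (by nlinarith), ?_⟩
  rw [Real.log_mul (by linarith) (by linarith : (0 : ℝ) < t).ne']
  linarith [Real.log_le_sub_one_of_pos (by linarith : (0 : ℝ) < t)]

/-- `log √N ≥ 0`. -/
theorem log_sqrt_nonneg : 0 ≤ Real.log (Real.sqrt N) := by
  have hN1 : (1 : ℝ) ≤ N := by exact_mod_cast NeZero.one_le
  exact Real.log_nonneg (by rw [← Real.sqrt_one]; exact Real.sqrt_le_sqrt hN1)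

/-- For `t ≥ 1`: `e^{−2πt}(log √N t)^j ≤ 2^j((log √N)^j + j!/π^j) · e^{−πt}`. -/
theorem exp_mul_logPow_le {t : ℝ} (ht : 1 ≤ t) (j : ℕ) :
    Real.exp (-(2 * π * t)) * (Real.log (Real.sqrt N * t)) ^ j ≤
      2 ^ j * ((Real.log (Real.sqrt N)) ^ j + (j.factorial : ℝ) / π ^ j) * Real.exp (-(π * t)) := by
  obtain ⟨h0, h1⟩ := log_sqrt_mul_bounds (N := N) ht
  have hL := log_sqrt_nonneg (N := N)
  have ht0 : 0 ≤ t := by linarith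
  have hsplit : Real.exp (-(2 * π * t)) = Real.exp (-(π * t)) * Real.exp (-(π * t)) := by
    rw [← Real.exp_add]; congr 1; ring
  -- `(a+b)^j ≤ (2 max a b)^j ≤ 2^j (a^j + b^j)`
  have hadd : (Real.log (Real.sqrt N) + t) ^ j ≤ 2 ^ j * ((Real.log (Real.sqrt N)) ^ j + t ^ j) := by
    have h2 : Real.log (Real.sqrt N) + t ≤ 2 * max (Real.log (Real.sqrt N)) t := by
      rcases le_total (Real.log (Real.sqrt N)) t with h | h
      · rw [max_eq_right h]; linarith
      · rw [max_eq_left h]; linarith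
    refine (pow_le_pow_left₀ (by positivity) h2 j).trans ?_
    rw [mul_pow]
    gcongr
    rcases le_total (Real.log (Real.sqrt N)) t with h | h
    · rw [max_eq_right h]; linarith [pow_nonneg hL j]
    · rw [max_eq_left h]; linarith [pow_nonneg ht0 j]
  have hpow : (Real.log (Real.sqrt N * t)) ^ j ≤ 2 ^ j * ((Real.log (Real.sqrt N)) ^ j + t ^ j) :=
    (pow_le_pow_left₀ h0 h1 j).trans hadd
  have he1 : Real.exp (-(π * t)) ≤ 1 := by rw [Real.exp_le_one_iff]; nlinarith [Real.pi_pos]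
  calc Real.exp (-(2 * π * t)) * (Real.log (Real.sqrt N * t)) ^ j
      ≤ Real.exp (-(2 * π * t)) * (2 ^ j * ((Real.log (Real.sqrt N)) ^ j + t ^ j)) :=
        mul_le_mul_of_nonneg_left hpow (Real.exp_pos _).le
    _ = 2 ^ j * ((Real.log (Real.sqrt N)) ^ j * Real.exp (-(π * t)) + t ^ j * Real.exp (-(π * t))) *
          Real.exp (-(π * t)) := by rw [hsplit]; ring
    _ ≤ 2 ^ j * ((Real.log (Real.sqrt N)) ^ j * 1 + (j.factorial : ℝ) / π ^ j) * Real.exp (-(π * t)) := by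
        gcongr
        exact pow_mul_exp_neg_pi_le j ht0
    _ = _ := by rw [mul_one]

/-- `∫_a^∞ e^{−πt} dt = e^{−πa}/π`. -/
theorem integral_exp_neg_pi_Ioi (a : ℝ) : ∫ t in Ioi a, Real.exp (-(π * t)) = Real.exp (-(π * a)) / π := by
  have h := integral_exp_mul_Ioi (a := -π) (by linarith [Real.pi_pos]) a
  simp only [neg_mul] at h
  rw [h]; field_simp

/-- **Tail integral with the log weight**: for `a ≥ 1`,
`∫_a^∞ e^{−2πt}(log √N t)^j dt ≤ 2^j((log √N)^j + j!/π^j) e^{−πa}/π`. -/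
theorem integral_exp_mul_logPow_tail_le {a : ℝ} (ha : 1 ≤ a) (j : ℕ) :
    ∫ t in Ioi a, Real.exp (-(2 * π * t)) * (Real.log (Real.sqrt N * t)) ^ j ≤
      2 ^ j * ((Real.log (Real.sqrt N)) ^ j + (j.factorial : ℝ) / π ^ j) * (Real.exp (-(π * a)) / π) := by
  set K : ℝ := 2 ^ j * ((Real.log (Real.sqrt N)) ^ j + (j.factorial : ℝ) / π ^ j) with hK
  have hint1 : IntegrableOn (fun t : ℝ ↦ Real.exp (-(2 * π * t)) * (Real.log (Real.sqrt N * t)) ^ j) (Ioi a) := by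
    refine IntegrableOn.congr_fun ((integrableOn_exp_abs_logPow_Ioi (N := N) j (by linarith : (0 : ℝ) ≤ a)))
      (fun t ht ↦ ?_) measurableSet_Ioi
    have ht : a < t := ht
    rw [abs_of_nonneg (log_sqrt_mul_bounds (N := N) (by linarith)).1]
  have hint2 : IntegrableOn (fun t : ℝ ↦ K * Real.exp (-(π * t))) (Ioi a) :=
    IntegrableOn.congr_fun ((exp_neg_integrableOn_Ioi a Real.pi_pos).const_mul K)
      (fun t _ ↦ by simp only [neg_mul]) measurableSet_Ioi
  calc ∫ t in Ioi a, Real.exp (-(2 * π * t)) * (Real.log (Real.sqrt N * t)) ^ j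
      ≤ ∫ t in Ioi a, K * Real.exp (-(π * t)) :=
        setIntegral_mono_on hint1 hint2 measurableSet_Ioi fun t ht ↦ exp_mul_logPow_le (N := N) (le_trans ha (le_of_lt ht)) j
    _ = K * (Real.exp (-(π * a)) / π) := by rw [integral_const_mul, integral_exp_neg_pi_Ioi]

/-! ## §2. The off-diagonal at all heights above `y` -/

/-- **Monotonicity in the height.** For `N` prime, `m ≥ 1`, a divisor constant `τ(r) ≤ C r^{1/4}`, every `R` and all
heights `0 < y ≤ t`: Bettin's split bound at height `t` is at most the split bound at height `y`, hence
`‖Σ_n n^{−1/2}e^{−2πnt} J(m,n)‖ ≤ B(y)`. [cite: Bettin2017, §2 (2.4)–(2.5) and §4] -/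
theorem norm_offDiag_le_of_le_height (hN : N.Prime) {m : ℕ} (hm : 1 ≤ m) {y t : ℝ} (hy : 0 < y) (hyt : y ≤ t)
    {C : ℝ} (hC : ∀ r : ℕ, ((r.divisors.card : ℕ) : ℝ) ≤ C * (r : ℝ) ^ (1 / 4 : ℝ)) (R : ℕ) :
    ‖∑' n : ℕ, (((n : ℝ) ^ (-(1 / 2 : ℝ)) * Real.exp (-(2 * π * n) * t) : ℝ) : ℂ) * petJ N m n‖ ≤
      2 * π / N *
        (2 * π * (3 + 2 * (-Real.log (1 - Real.exp (-(2 * π * y))))) *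
            (1 + Real.log ((N : ℝ) * (R + 1))) * Real.sqrt m * (∑ r ∈ range (R + 1), (r : ℝ)⁻¹) +
          4 * π * C * Real.sqrt m * (N : ℝ) ^ (-(1 / 2 : ℝ)) * ((π * y)⁻¹ * ((π * y)⁻¹ + 1)) *
            ((((R + 1 : ℕ) : ℝ)) ^ (-(1 / 8 : ℝ)) *
              ∑' r : ℕ, (((r + 1 : ℕ) : ℝ)) ^ (-(9 / 8 : ℝ)))) := by
  have ht : 0 < t := lt_of_lt_of_le hy hyt
  have hC0 : 0 ≤ C := by have h := hC 1; simp at h; linarith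
  have main := Bettin2017.norm_tsum_weight_mul_petJ_le hN hm ht hC R
  refine main.trans ?_
  -- monotone pieces
  have he_t : Real.exp (-(2 * π * t)) ≤ Real.exp (-(2 * π * y)) := Real.exp_le_exp.mpr (by nlinarith [Real.pi_pos])
  have he_y1 : Real.exp (-(2 * π * y)) < 1 := by
    rw [← Real.exp_zero]; exact Real.exp_lt_exp.mpr (by nlinarith [Real.pi_pos])
  have hΛ : -Real.log (1 - Real.exp (-(2 * π * t))) ≤ -Real.log (1 - Real.exp (-(2 * π * y))) := by
    have h1 : 0 < 1 - Real.exp (-(2 * π * y)) := by linarith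
    exact neg_le_neg (Real.log_le_log h1 (by linarith))
  have hΛ0 : 0 ≤ -Real.log (1 - Real.exp (-(2 * π * t))) := by
    rw [neg_nonneg]
    exact Real.log_nonpos (by linarith [he_t, he_y1]) (by linarith [Real.exp_pos (-(2 * π * t))])
  have hinv : (π * t)⁻¹ ≤ (π * y)⁻¹ := inv_anti₀ (by positivity) (by nlinarith [Real.pi_pos])
  have hinv0 : 0 ≤ (π * t)⁻¹ := by positivity
  have hlogNR : 0 ≤ 1 + Real.log ((N : ℝ) * (R + 1)) := by
    have : 0 ≤ Real.log ((N : ℝ) * (R + 1)) := by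
      apply Real.log_nonneg
      have h1 : (1 : ℝ) ≤ N := by exact_mod_cast hN.one_lt.le
      have h2 : (1 : ℝ) ≤ (R : ℝ) + 1 := by have : (0 : ℝ) ≤ R := Nat.cast_nonneg R; linarith
      nlinarith
    linarith
  have hH0 : 0 ≤ ∑ r ∈ range (R + 1), (r : ℝ)⁻¹ := Finset.sum_nonneg fun r _ ↦ inv_nonneg.mpr (Nat.cast_nonneg r)
  have hZ0 : 0 ≤ (((R + 1 : ℕ) : ℝ)) ^ (-(1 / 8 : ℝ)) * ∑' r : ℕ, (((r + 1 : ℕ) : ℝ)) ^ (-(9 / 8 : ℝ)) :=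
    mul_nonneg (Real.rpow_nonneg (Nat.cast_nonneg _) _) (tsum_nonneg fun r ↦ Real.rpow_nonneg (Nat.cast_nonneg _) _)
  have hN0 : (0 : ℝ) < N := by exact_mod_cast hN.pos
  gcongr

/-! ## §3. The size of the height bound at `y = 1/(mN²)`, `R + 1 = m^{16} N^{28}` -/

/-- `−log(1 − e^{−s}) ≤ log(1 + s⁻¹)` for `s > 0`. -/
theorem neg_log_one_sub_exp_le' {s : ℝ} (hs : 0 < s) :
    -Real.log (1 - Real.exp (-s)) ≤ Real.log (1 + s⁻¹) := by
  have he0 : 0 < Real.exp (-s) := Real.exp_pos _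
  have he1 : Real.exp (-s) < 1 := by
    rw [← Real.exp_zero]; exact Real.exp_lt_exp.mpr (by linarith)
  have ha : 0 < 1 - Real.exp (-s) := by linarith
  rw [← Real.log_inv]
  apply Real.log_le_log (inv_pos.mpr ha)
  rw [inv_le_iff_one_le_mul₀ ha]
  have h := Real.add_one_le_exp s
  have hprod : Real.exp (-s) * Real.exp s = 1 := by rw [← Real.exp_add]; simp
  have hx : Real.exp (-s) * (1 + s) ≤ 1 := by nlinarith
  have heq : (1 + s⁻¹) * (1 - Real.exp (-s)) = 1 + (1 - Real.exp (-s) * (1 + s)) * s⁻¹ := by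
    field_simp; ring
  rw [heq]
  have : 0 ≤ (1 - Real.exp (-s) * (1 + s)) * s⁻¹ := mul_nonneg (by linarith) (inv_pos.mpr hs).le
  linarith

/-- **The height bound at Bettin's height is `≪ (1 + log N)³ √m / N`** (`N` prime, `1 ≤ m ≤ N`, `y = 1/(mN²)`,
`R + 1 = m^{16}N^{28}`): there is an absolute `C₀` (depending only on the divisor constant) bounding the explicit split
bound by `C₀ (1 + log N)³ √m N⁻¹`. [cite: Bettin2017, §2 (2.4)–(2.5), §4 («m ≪ N^{100}»)] -/
theorem offDiag_heightBound_le {C : ℝ} (hC0 : 0 ≤ C) :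
    ∀ (N : ℕ), N.Prime → ∀ m : ℕ, 1 ≤ m → m ≤ N →
      2 * π / N *
        (2 * π * (3 + 2 * (-Real.log (1 - Real.exp (-(2 * π * (1 / ((m : ℝ) * (N : ℝ) ^ 2))))))) *
            (1 + Real.log ((N : ℝ) * ((m ^ 16 * N ^ 28 - 1 : ℕ) + 1))) * Real.sqrt m *
              (∑ r ∈ range ((m ^ 16 * N ^ 28 - 1 : ℕ) + 1), (r : ℝ)⁻¹) +
          4 * π * C * Real.sqrt m * (N : ℝ) ^ (-(1 / 2 : ℝ)) *
            ((π * (1 / ((m : ℝ) * (N : ℝ) ^ 2)))⁻¹ * ((π * (1 / ((m : ℝ) * (N : ℝ) ^ 2)))⁻¹ + 1)) *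
            (((((m ^ 16 * N ^ 28 - 1 : ℕ) + 1 : ℕ) : ℝ)) ^ (-(1 / 8 : ℝ)) *
              ∑' r : ℕ, (((r + 1 : ℕ) : ℝ)) ^ (-(9 / 8 : ℝ)))) ≤
        (2 * π * (2 * π * 9 * 45 * 45 + 8 * C * (∑' r : ℕ, (((r + 1 : ℕ) : ℝ)) ^ (-(9 / 8 : ℝ))))) *
          (1 + Real.log N) ^ 3 * Real.sqrt m / N := by
  intro N hN m hm hmN
  set Z : ℝ := ∑' r : ℕ, (((r + 1 : ℕ) : ℝ)) ^ (-(9 / 8 : ℝ)) with hZ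
  have hZ0 : 0 ≤ Z := tsum_nonneg fun r ↦ Real.rpow_nonneg (Nat.cast_nonneg _) _
  have hN2 : (2 : ℝ) ≤ N := by exact_mod_cast hN.two_le
  have hN0 : (0 : ℝ) < N := by linarith
  have hN1 : (1 : ℝ) ≤ N := by linarith
  have hm1 : (1 : ℝ) ≤ m := by exact_mod_cast hm
  have hm0 : (0 : ℝ) < m := by linarith
  have hmN' : (m : ℝ) ≤ N := by exact_mod_cast hmN
  set L : ℝ := Real.log N with hL
  have hL0 : 0 < L := Real.log_pos (by linarith)
  have hlogm : Real.log m ≤ L := Real.log_le_log hm0 hmN'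
  have hlogm0 : 0 ≤ Real.log m := Real.log_nonneg hm1
  -- `R + 1 = m^16 N^28`
  have hmN1 : 1 ≤ m ^ 16 * N ^ 28 :=
    Nat.one_le_iff_ne_zero.mpr (mul_ne_zero (pow_ne_zero _ (by omega)) (pow_ne_zero _ hN.ne_zero))
  have hR1 : (m ^ 16 * N ^ 28 - 1 : ℕ) + 1 = m ^ 16 * N ^ 28 := by omega
  have hR1r : (((m ^ 16 * N ^ 28 - 1 : ℕ) + 1 : ℕ) : ℝ) = (m : ℝ) ^ 16 * (N : ℝ) ^ 28 := by
    rw [hR1]; push_cast; ring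
  have hR1r' : ((m ^ 16 * N ^ 28 - 1 : ℕ) : ℝ) + 1 = (m : ℝ) ^ 16 * (N : ℝ) ^ 28 := by exact_mod_cast hR1r
  rw [hR1r', hR1r]
  -- the logarithms
  have hlog1 : Real.log ((N : ℝ) * ((m : ℝ) ^ 16 * (N : ℝ) ^ 28)) ≤ 45 * L := by
    rw [show (N : ℝ) * ((m : ℝ) ^ 16 * (N : ℝ) ^ 28) = (m : ℝ) ^ 16 * (N : ℝ) ^ 29 by ring,
      Real.log_mul (by positivity) (by positivity), Real.log_pow, Real.log_pow, ← hL]; push_cast; nlinarith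
  have hlog2 : Real.log ((m : ℝ) ^ 16 * (N : ℝ) ^ 28) ≤ 44 * L := by
    rw [Real.log_mul (by positivity) (by positivity), Real.log_pow, Real.log_pow, ← hL]; push_cast; nlinarith
  have hH : ∑ r ∈ range ((m ^ 16 * N ^ 28 - 1 : ℕ) + 1), (r : ℝ)⁻¹ ≤ 45 * (1 + L) := by
    refine (Bettin2017.sum_range_succ_inv_le _).trans ?_
    rw [hR1r']
    linarith
  have hΛ : -Real.log (1 - Real.exp (-(2 * π * (1 / ((m : ℝ) * (N : ℝ) ^ 2))))) ≤ 3 * L := by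
    have h1 := neg_log_one_sub_exp_le' (s := 2 * π * (1 / ((m : ℝ) * (N : ℝ) ^ 2))) (by positivity)
    refine h1.trans ?_
    have hinv : (2 * π * (1 / ((m : ℝ) * (N : ℝ) ^ 2)))⁻¹ = (m : ℝ) * (N : ℝ) ^ 2 / (2 * π) := by field_simp
    have h2 : 1 + (2 * π * (1 / ((m : ℝ) * (N : ℝ) ^ 2)))⁻¹ ≤ (m : ℝ) * (N : ℝ) ^ 2 := by
      rw [hinv]
      have hπ : (2 : ℝ) ≤ 2 * π := by linarith [Real.pi_gt_three]
      have hmN4 : (4 : ℝ) ≤ (m : ℝ) * (N : ℝ) ^ 2 := by nlinarith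
      have h3 : (m : ℝ) * (N : ℝ) ^ 2 / (2 * π) ≤ (m : ℝ) * (N : ℝ) ^ 2 / 2 :=
        div_le_div_of_nonneg_left (by positivity) (by norm_num) hπ
      linarith
    calc Real.log (1 + (2 * π * (1 / ((m : ℝ) * (N : ℝ) ^ 2)))⁻¹) ≤ Real.log ((m : ℝ) * (N : ℝ) ^ 2) :=
          Real.log_le_log (by positivity) h2
      _ = Real.log m + 2 * L := by rw [Real.log_mul (by positivity) (by positivity), Real.log_pow, hL]; push_cast; ring
      _ ≤ 3 * L := by linarith
  have hΛ0 : 0 ≤ -Real.log (1 - Real.exp (-(2 * π * (1 / ((m : ℝ) * (N : ℝ) ^ 2))))) := by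
    have he1 : Real.exp (-(2 * π * (1 / ((m : ℝ) * (N : ℝ) ^ 2)))) < 1 :=
      Real.exp_lt_one_iff.mpr (by
        have : 0 < 2 * π * (1 / ((m : ℝ) * (N : ℝ) ^ 2)) := by positivity
        linarith)
    rw [neg_nonneg]
    exact Real.log_nonpos (by linarith [he1]) (by linarith [Real.exp_pos (-(2 * π * (1 / ((m : ℝ) * (N : ℝ) ^ 2))))])
  -- the head
  have hhead : 2 * π * (3 + 2 * (-Real.log (1 - Real.exp (-(2 * π * (1 / ((m : ℝ) * (N : ℝ) ^ 2))))))) *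
        (1 + Real.log ((N : ℝ) * ((m : ℝ) ^ 16 * (N : ℝ) ^ 28))) * Real.sqrt m *
          (∑ r ∈ range ((m ^ 16 * N ^ 28 - 1 : ℕ) + 1), (r : ℝ)⁻¹) ≤
      2 * π * 9 * 45 * 45 * (1 + L) ^ 3 * Real.sqrt m := by
    have e1 : 3 + 2 * (-Real.log (1 - Real.exp (-(2 * π * (1 / ((m : ℝ) * (N : ℝ) ^ 2)))))) ≤ 9 * (1 + L) := by
      linarith
    have e2 : 1 + Real.log ((N : ℝ) * ((m : ℝ) ^ 16 * (N : ℝ) ^ 28)) ≤ 45 * (1 + L) := by linarith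
    have e20 : 0 ≤ 1 + Real.log ((N : ℝ) * ((m : ℝ) ^ 16 * (N : ℝ) ^ 28)) := by
      have : 0 ≤ Real.log ((N : ℝ) * ((m : ℝ) ^ 16 * (N : ℝ) ^ 28)) :=
        Real.log_nonneg (by nlinarith [one_le_pow₀ (n := 16) hm1, one_le_pow₀ (n := 28) hN1])
      linarith
    have hH0 : 0 ≤ ∑ r ∈ range ((m ^ 16 * N ^ 28 - 1 : ℕ) + 1), (r : ℝ)⁻¹ :=
      Finset.sum_nonneg fun r _ ↦ inv_nonneg.mpr (Nat.cast_nonneg r)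
    have hprod := mul_le_mul (mul_le_mul e1 e2 e20 (by positivity)) hH hH0 (by positivity)
    calc 2 * π * (3 + 2 * (-Real.log (1 - Real.exp (-(2 * π * (1 / ((m : ℝ) * (N : ℝ) ^ 2))))))) *
          (1 + Real.log ((N : ℝ) * ((m : ℝ) ^ 16 * (N : ℝ) ^ 28))) * Real.sqrt m *
            (∑ r ∈ range ((m ^ 16 * N ^ 28 - 1 : ℕ) + 1), (r : ℝ)⁻¹)
        = 2 * π * Real.sqrt m * ((3 + 2 * (-Real.log (1 - Real.exp (-(2 * π * (1 / ((m : ℝ) * (N : ℝ) ^ 2))))))) *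
            (1 + Real.log ((N : ℝ) * ((m : ℝ) ^ 16 * (N : ℝ) ^ 28))) *
              (∑ r ∈ range ((m ^ 16 * N ^ 28 - 1 : ℕ) + 1), (r : ℝ)⁻¹)) := by ring
      _ ≤ 2 * π * Real.sqrt m * ((9 * (1 + L)) * (45 * (1 + L)) * (45 * (1 + L))) :=
          mul_le_mul_of_nonneg_left hprod (by positivity)
      _ = 2 * π * 9 * 45 * 45 * (1 + L) ^ 3 * Real.sqrt m := by ring
  -- the tail
  have hπy : (π * (1 / ((m : ℝ) * (N : ℝ) ^ 2)))⁻¹ = (m : ℝ) * (N : ℝ) ^ 2 / π := by field_simp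
  have hπy1 : (m : ℝ) * (N : ℝ) ^ 2 / π + 1 ≤ 2 * ((m : ℝ) * (N : ℝ) ^ 2 / π) := by
    have h1 : (1 : ℝ) ≤ (m : ℝ) * (N : ℝ) ^ 2 / π := by
      rw [le_div_iff₀ Real.pi_pos]; nlinarith [Real.pi_lt_four]
    linarith
  have hRpow : ((m : ℝ) ^ 16 * (N : ℝ) ^ 28) ^ (-(1 / 8 : ℝ)) = (m : ℝ) ^ (-(2 : ℝ)) * (N : ℝ) ^ (-(7 / 2 : ℝ)) := by
    rw [Real.mul_rpow (by positivity) (by positivity), show ((m : ℝ) ^ 16) = (m : ℝ) ^ ((16 : ℕ) : ℝ) by rw [Real.rpow_natCast],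
      show ((N : ℝ) ^ 28) = (N : ℝ) ^ ((28 : ℕ) : ℝ) by rw [Real.rpow_natCast],
      ← Real.rpow_mul hm0.le, ← Real.rpow_mul hN0.le]
    norm_num
  have hNpow : (N : ℝ) ^ (-(1 / 2 : ℝ)) * ((N : ℝ) ^ 2) ^ 2 * (N : ℝ) ^ (-(7 / 2 : ℝ)) = 1 := by
    rw [show ((N : ℝ) ^ 2) ^ 2 = (N : ℝ) ^ ((4 : ℕ) : ℝ) by rw [Real.rpow_natCast]; ring,
      ← Real.rpow_add hN0, ← Real.rpow_add hN0]; norm_num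
  have hmpow : (m : ℝ) ^ 2 * (m : ℝ) ^ (-(2 : ℝ)) = 1 := by
    rw [show (m : ℝ) ^ 2 = (m : ℝ) ^ ((2 : ℕ) : ℝ) by rw [Real.rpow_natCast], ← Real.rpow_add hm0]; norm_num
  have htail : 4 * π * C * Real.sqrt m * (N : ℝ) ^ (-(1 / 2 : ℝ)) *
        ((π * (1 / ((m : ℝ) * (N : ℝ) ^ 2)))⁻¹ * ((π * (1 / ((m : ℝ) * (N : ℝ) ^ 2)))⁻¹ + 1)) *
          (((m : ℝ) ^ 16 * (N : ℝ) ^ 28) ^ (-(1 / 8 : ℝ)) * Z) ≤ 8 * C * Z / π * Real.sqrt m := by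
    rw [hπy]
    have step : (m : ℝ) * (N : ℝ) ^ 2 / π * ((m : ℝ) * (N : ℝ) ^ 2 / π + 1) ≤
        ((m : ℝ) * (N : ℝ) ^ 2 / π) * (2 * ((m : ℝ) * (N : ℝ) ^ 2 / π)) :=
      mul_le_mul_of_nonneg_left hπy1 (by positivity)
    have hfac0 : 0 ≤ 4 * π * C * Real.sqrt m * (N : ℝ) ^ (-(1 / 2 : ℝ)) := by positivity
    have hfac1 : 0 ≤ ((m : ℝ) ^ 16 * (N : ℝ) ^ 28) ^ (-(1 / 8 : ℝ)) * Z :=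
      mul_nonneg (Real.rpow_nonneg (by positivity) _) hZ0
    calc 4 * π * C * Real.sqrt m * (N : ℝ) ^ (-(1 / 2 : ℝ)) *
          ((m : ℝ) * (N : ℝ) ^ 2 / π * ((m : ℝ) * (N : ℝ) ^ 2 / π + 1)) * (((m : ℝ) ^ 16 * (N : ℝ) ^ 28) ^ (-(1 / 8 : ℝ)) * Z)
        ≤ 4 * π * C * Real.sqrt m * (N : ℝ) ^ (-(1 / 2 : ℝ)) *
            (((m : ℝ) * (N : ℝ) ^ 2 / π) * (2 * ((m : ℝ) * (N : ℝ) ^ 2 / π))) *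
            (((m : ℝ) ^ 16 * (N : ℝ) ^ 28) ^ (-(1 / 8 : ℝ)) * Z) :=
          mul_le_mul_of_nonneg_right (mul_le_mul_of_nonneg_left step hfac0) hfac1
      _ = 8 * C * Z / π * Real.sqrt m *
            ((N : ℝ) ^ (-(1 / 2 : ℝ)) * ((N : ℝ) ^ 2) ^ 2 * (N : ℝ) ^ (-(7 / 2 : ℝ))) *
            ((m : ℝ) ^ 2 * (m : ℝ) ^ (-(2 : ℝ))) := by
          rw [hRpow]; field_simp; try ring
      _ = 8 * C * Z / π * Real.sqrt m := by rw [hNpow, hmpow]; ring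
  -- assemble
  have htail' : 8 * C * Z / π * Real.sqrt m ≤ 8 * C * Z * (1 + L) ^ 3 * Real.sqrt m :=
    mul_le_mul_of_nonneg_right ((div_le_self (by positivity) (by linarith [Real.pi_gt_three])).trans
      (le_mul_of_one_le_right (by positivity) (one_le_pow₀ (by linarith)))) (Real.sqrt_nonneg _)
  calc 2 * π / N * (2 * π * (3 + 2 * (-Real.log (1 - Real.exp (-(2 * π * (1 / ((m : ℝ) * (N : ℝ) ^ 2))))))) *
          (1 + Real.log ((N : ℝ) * ((m : ℝ) ^ 16 * (N : ℝ) ^ 28))) * Real.sqrt m *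
            (∑ r ∈ range ((m ^ 16 * N ^ 28 - 1 : ℕ) + 1), (r : ℝ)⁻¹) +
        4 * π * C * Real.sqrt m * (N : ℝ) ^ (-(1 / 2 : ℝ)) *
          ((π * (1 / ((m : ℝ) * (N : ℝ) ^ 2)))⁻¹ * ((π * (1 / ((m : ℝ) * (N : ℝ) ^ 2)))⁻¹ + 1)) *
          (((m : ℝ) ^ 16 * (N : ℝ) ^ 28) ^ (-(1 / 8 : ℝ)) * Z))
      ≤ 2 * π / N * (2 * π * 9 * 45 * 45 * (1 + L) ^ 3 * Real.sqrt m + 8 * C * Z * (1 + L) ^ 3 * Real.sqrt m) :=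
        mul_le_mul_of_nonneg_left (add_le_add hhead (htail.trans htail')) (by positivity)
    _ = (2 * π * (2 * π * 9 * 45 * 45 + 8 * C * Z)) * (1 + L) ^ 3 * Real.sqrt m / N := by
        field_simp

/-! ## §4. The Weil regime `t ≥ 1` -/

/-- **Weil's bound termwise at heights `t ≥ 1`**: with `‖J(m,n)‖ ≤ K√(m,n)√(mn)N^{−3/2}` (`norm_petJ_le_all`),
`‖Σ_n n^{−1/2}e^{−2πnt}J(m,n)‖ ≤ 4K m N^{−3/2} e^{−2πt}` for every prime `N`, `m ≥ 1`, `t ≥ 1`.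
[cite: KowalskiMichel2000, §2.4.2 p. 312 (23)] -/
theorem norm_offDiag_le_weil :
    ∃ K : ℝ, 0 ≤ K ∧ ∀ (N : ℕ) [NeZero N], N.Prime → ∀ m : ℕ, 1 ≤ m → ∀ t : ℝ, 1 ≤ t →
      Summable (fun n : ℕ ↦ (((n : ℝ) ^ (-(1 / 2 : ℝ)) * Real.exp (-(2 * π * n) * t) : ℝ) : ℂ) * petJ N m n) ∧
      ‖∑' n : ℕ, (((n : ℝ) ^ (-(1 / 2 : ℝ)) * Real.exp (-(2 * π * n) * t) : ℝ) : ℂ) * petJ N m n‖ ≤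
        4 * K * m * (N : ℝ) ^ (-(3 / 2 : ℝ)) * Real.exp (-(2 * π * t)) := by
  obtain ⟨K, hK0, hK⟩ := norm_petJ_le_all
  refine ⟨K, hK0, fun N _ hN m hm t ht ↦ ?_⟩
  have hN0 : (0 : ℝ) < N := by exact_mod_cast hN.pos
  have hm1 : (1 : ℝ) ≤ m := by exact_mod_cast hm
  have hm0 : (0 : ℝ) < m := by linarith
  -- `r = e^{−2πt} ∈ (0, ½]`
  have hr0 : 0 < Real.exp (-(2 * π * t)) := Real.exp_pos _
  have hr12 : Real.exp (-(2 * π * t)) ≤ 1 / 2 := by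
    have h2 : (2 : ℝ) ≤ Real.exp 1 := by linarith [Real.add_one_le_exp (1 : ℝ)]
    exact (Real.exp_le_exp.mpr (by nlinarith [Real.pi_gt_three] : -(2 * π * t) ≤ -1)).trans
      (by rw [Real.exp_neg, one_div]; exact inv_anti₀ (by norm_num) h2)
  have hr1 : ‖Real.exp (-(2 * π * t))‖ < 1 := by rw [Real.norm_of_nonneg hr0.le]; linarith
  have hG : HasSum (fun n : ℕ ↦ K * m * (N : ℝ) ^ (-(3 / 2 : ℝ)) * (n * Real.exp (-(2 * π * t)) ^ n))
      (K * m * (N : ℝ) ^ (-(3 / 2 : ℝ)) * (Real.exp (-(2 * π * t)) / (1 - Real.exp (-(2 * π * t))) ^ 2)) :=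
    (hasSum_coe_mul_geometric_of_norm_lt_one hr1).mul_left _
  have hbound : ∀ n : ℕ, ‖(((n : ℝ) ^ (-(1 / 2 : ℝ)) * Real.exp (-(2 * π * n) * t) : ℝ) : ℂ) * petJ N m n‖ ≤
      K * m * (N : ℝ) ^ (-(3 / 2 : ℝ)) * (n * Real.exp (-(2 * π * t)) ^ n) := by
    intro n
    rcases Nat.eq_zero_or_pos n with rfl | hn
    · simp
    · have hn1 : (1 : ℝ) ≤ n := by exact_mod_cast hn
      have hn0 : (0 : ℝ) < n := by linarith
      have hJ := hK N hN m n hm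
      -- `√(m,n) ≤ √m`, `n^{-1/2} √(mn) = √m`
      have hg : Real.sqrt ((m.gcd n : ℕ) : ℝ) ≤ Real.sqrt m :=
        Real.sqrt_le_sqrt (by exact_mod_cast Nat.gcd_le_left n hm)
      have hexp : Real.exp (-(2 * π * n) * t) = Real.exp (-(2 * π * t)) ^ n := by
        rw [← Real.exp_nat_mul]; congr 1; ring
      have hw0 : 0 ≤ (n : ℝ) ^ (-(1 / 2 : ℝ)) * Real.exp (-(2 * π * n) * t) := by positivity
      rw [norm_mul, Complex.norm_real, Real.norm_of_nonneg hw0]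
      have hJ' : ‖petJ N m n‖ ≤ K * Real.sqrt m * Real.sqrt ((m : ℝ) * n) * (N : ℝ) ^ (-(3 / 2 : ℝ)) :=
        hJ.trans (by gcongr)
      have hss : (n : ℝ) ^ (-(1 / 2 : ℝ)) * Real.sqrt ((m : ℝ) * n) = Real.sqrt m := by
        rw [Real.sqrt_mul hm0.le, Real.sqrt_eq_rpow (n : ℝ), mul_comm, mul_assoc, ← Real.rpow_add hn0]
        norm_num
      have hmm : Real.sqrt m * Real.sqrt m = m := Real.mul_self_sqrt hm0.le
      calc (n : ℝ) ^ (-(1 / 2 : ℝ)) * Real.exp (-(2 * π * n) * t) * ‖petJ N m n‖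
          ≤ (n : ℝ) ^ (-(1 / 2 : ℝ)) * Real.exp (-(2 * π * n) * t) *
              (K * Real.sqrt m * Real.sqrt ((m : ℝ) * n) * (N : ℝ) ^ (-(3 / 2 : ℝ))) :=
            mul_le_mul_of_nonneg_left hJ' hw0
        _ = K * (Real.sqrt m * ((n : ℝ) ^ (-(1 / 2 : ℝ)) * Real.sqrt ((m : ℝ) * n))) * (N : ℝ) ^ (-(3 / 2 : ℝ)) *
              Real.exp (-(2 * π * t)) ^ n := by rw [hexp]; ring
        _ = K * m * (N : ℝ) ^ (-(3 / 2 : ℝ)) * (1 * Real.exp (-(2 * π * t)) ^ n) := by rw [hss, hmm]; ring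
        _ ≤ K * m * (N : ℝ) ^ (-(3 / 2 : ℝ)) * (n * Real.exp (-(2 * π * t)) ^ n) := by gcongr
  have hsum : Summable (fun n : ℕ ↦ (((n : ℝ) ^ (-(1 / 2 : ℝ)) * Real.exp (-(2 * π * n) * t) : ℝ) : ℂ) * petJ N m n) :=
    Summable.of_norm_bounded hG.summable hbound
  refine ⟨hsum, (tsum_of_norm_bounded hG hbound).trans ?_⟩
  have hgeom : Real.exp (-(2 * π * t)) / (1 - Real.exp (-(2 * π * t))) ^ 2 ≤ 4 * Real.exp (-(2 * π * t)) := by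
    have h1r : (1 : ℝ) / 2 ≤ 1 - Real.exp (-(2 * π * t)) := by linarith
    have hpos : (0 : ℝ) < (1 - Real.exp (-(2 * π * t))) ^ 2 := pow_pos (by linarith) 2
    rw [div_le_iff₀ hpos]
    nlinarith [mul_nonneg hr0.le (by nlinarith [h1r] : (0 : ℝ) ≤ 4 * (1 - Real.exp (-(2 * π * t))) ^ 2 - 1)]
  calc K * m * (N : ℝ) ^ (-(3 / 2 : ℝ)) * (Real.exp (-(2 * π * t)) / (1 - Real.exp (-(2 * π * t))) ^ 2)
      ≤ K * m * (N : ℝ) ^ (-(3 / 2 : ℝ)) * (4 * Real.exp (-(2 * π * t))) :=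
        mul_le_mul_of_nonneg_left hgeom (by positivity)
    _ = 4 * K * m * (N : ℝ) ^ (-(3 / 2 : ℝ)) * Real.exp (-(2 * π * t)) := by ring

end Summit.Parity.GeneralizedHardyLittlewood.Theorems.MomentsBeyondDiagonal.FirstOrderAFE

end
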